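import Literature.NumberTheory.ModularForms.GammaLevelRaise
import Literature.NumberTheory.EllipticCurves.DeligneSerreProp27LevelDescentProofs
import HarnessLib

/-!
# Bounded denominators of `K`-rational forms on `Γ(N)` (`K` a number field)

Topic `Literature/NumberTheory/ModularForms`; namespace `Literature.NumberTheory.ModularForms`.
The integrality half of the `q`-expansion principle for translates (Shimura 1971, Thm. 3.52 (1)–(2):
`M_k(Γ(N))` is spanned by forms with Fourier coefficients in `ℤ[ζ_N]`-multiples, hence a form with
coefficients in a number field has bounded denominators; Deligne–Serre 1974, Rem. 2.8), obtained
here from the tree's **Deligne–Serre integral spanning set** of `S_κ(Γ₁(M))`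
(`DeligneSerre1974_span_integralLattice1_holds`) and the level raise of `GammaLevelRaise`:

* `exists_int_mul_isIntegral_cuspCoeff` — a cusp form on `Γ₁(M)` (weight `≥ 1`) whose
  coefficients lie in a number field `K ⊂ ℂ` has bounded denominators: write it over `ℂ` in the
  integral spanning set, descend the coordinates to `K` by a `K`-linear retraction `ℂ → K`
  (`exists_coords_mem_of_forall_mem`), and clear the denominators of the finitely many
  coordinates (`Algebra.IsAlgebraic.exists_integral_multiples`);
* `exists_int_mul_isIntegral_coeff` — **for `g ∈ M_k(Γ(N))`, `k ≥ 1`, with `q_N`-coefficients in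
  `K`: some nonzero integer multiple of all coefficients is integral over `ℤ`** (apply the above to
  `(g ∣ diag(N,1))·Δ ∈ S_{k+12}(Γ₁(N²))` and divide by `Δ = q·(unit of ℤ⟦q⟧)`).

Everything is proved (no named fact).

## References

* [ShimuraIATAF1971] G. Shimura, *Introduction to the arithmetic theory of automorphic
  functions*, Princeton (1971), Thm. 3.52.
* [DeligneSerreASENS1974] P. Deligne, J.-P. Serre, *Formes modulaires de poids 1*, ASENS 7
  (1974), Prop. 2.7, Rem. 2.8.
* [DiamondShurman2005] F. Diamond, J. Shurman, *A First Course in Modular Forms*, GTM 228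
  (2005), §6.5 (Thm. 6.5.1: integral structure on `S_2(Γ₁(N))`).
-/

noncomputable section

namespace Literature.NumberTheory.ModularForms

open scoped MatrixGroups Real CongruenceSubgroup Matrix ModularForm Topology Manifold
open UpperHalfPlane hiding I
open Complex Filter Function ModularForm PowerSeries
open Literature.NumberTheory.EllipticCurves.ModularForms (formSpace cuspCoeff cuspCoeffₗ
  integralLattice1 DeligneSerre1974_span_integralLattice1_holds
  exists_int_eq_cuspCoeff_of_mem_integralLattice1)
open Literature.NumberTheory.EllipticCurves.ModularForms.HeckeTGamma1 (one_mem_strictPeriods_Gamma1)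
open Literature.NumberTheory.EllipticCurves (formalDeltaUnit constantCoeff_formalDeltaUnit)

/-! ### Denominators of `K`-rational cusp forms on `Γ₁(M)` -/

section CuspDenominators

variable (K : IntermediateField ℚ ℂ) [FiniteDimensional ℚ K]

/-- Elements of a number field `K ⊂ ℂ` have integral multiples: for finitely many `xᵢ ∈ K` there
is `0 ≠ D ∈ ℤ` with all `D xᵢ` integral over `ℤ`. [folklore] -/
theorem exists_int_mul_isIntegral_of_mem {ι : Type*} [Fintype ι] (x : ι → ℂ) (hx : ∀ i, x i ∈ K.toSubfield) :
    ∃ D : ℤ, D ≠ 0 ∧ ∀ i, IsIntegral ℤ ((D : ℂ) * x i) := by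
  classical
  have halgQ : Algebra.IsAlgebraic ℚ K := Algebra.IsAlgebraic.of_finite ℚ K
  have halg : Algebra.IsAlgebraic ℤ K := (IsFractionRing.comap_isAlgebraic_iff (A := ℤ) (K := ℚ) (C := K)).mpr halgQ
  let y : ι → K := fun i ↦ ⟨x i, hx i⟩
  obtain ⟨D, hD0, hD⟩ := Algebra.IsAlgebraic.exists_integral_multiples ℤ (Finset.univ.image y)
  refine ⟨D, hD0, fun i ↦ ?_⟩
  have h1 : IsIntegral ℤ (D • y i) := hD _ (Finset.mem_image_of_mem y (Finset.mem_univ i))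
  have h2 : IsIntegral ℤ (algebraMap K ℂ (D • y i)) := h1.algebraMap
  have h3 : algebraMap K ℂ (D • y i) = (D : ℂ) * x i := by
    rw [map_zsmul, zsmul_eq_mul]
    rfl
  rwa [h3] at h2

/-- **Bounded denominators for `K`-rational cusp forms on `Γ₁(M)`** (`K ⊂ ℂ` a number field,
weight `κ ≥ 1`): from the Deligne–Serre integral spanning set `L` of `S_κ(Γ₁(M))`
(`DeligneSerre1974_span_integralLattice1_holds`), `C = ∑ cᵢ hᵢ` with `hᵢ ∈ L`; the coordinates
descend to `K` (a `K`-linear retraction `ℂ → K` fixes the `K`-valued coefficients of `C` and the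
integer ones of the `hᵢ`), and finitely many elements of `K` have a common denominator.
[cite: DeligneSerreASENS1974, Prop. 2.7 and Rem. 2.8] -/
theorem exists_int_mul_isIntegral_cuspCoeff {M : ℕ} [NeZero M] {κ : ℤ} (hκ : 1 ≤ κ)
    (C : CuspForm (CongruenceSubgroup.Gamma1 M) κ) (hC : ∀ n, cuspCoeff C n ∈ K.toSubfield) :
    ∃ D : ℤ, D ≠ 0 ∧ ∀ n, IsIntegral ℤ ((D : ℂ) * cuspCoeff C n) := by
  classical
  have hspan := DeligneSerre1974_span_integralLattice1_holds M κ hκ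
  have hCmem : C ∈ Submodule.span ℂ (integralLattice1 M κ : Set (CuspForm (CongruenceSubgroup.Gamma1 M) κ)) := by
    rw [hspan]
    exact Submodule.mem_top
  obtain ⟨m, c, h, hsum⟩ := Submodule.mem_span_set'.mp hCmem
  -- the `hᵢ` have integer coefficients
  have hz' : ∀ (i : Fin m) (n : ℕ), ∃ z : ℤ, (z : ℂ) = cuspCoeff (h i).1 n :=
    fun i n ↦ exists_int_eq_cuspCoeff_of_mem_integralLattice1 (h i).2 n
  choose z hz using hz'
  -- coefficientwise: `aₙ(C) = ∑ cᵢ aₙ(hᵢ)`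
  have hcoef : ∀ n, cuspCoeff C n = ∑ i, c i * (z i n : ℂ) := by
    intro n
    have := congrArg (cuspCoeffₗ (k := κ) (one_mem_strictPeriods_Gamma1 M) n) hsum
    rw [map_sum] at this
    simp only [map_smul, smul_eq_mul] at this
    change _ = cuspCoeff C n at this
    rw [← this]
    refine Finset.sum_congr rfl fun i _ ↦ ?_
    rw [hz]
    rfl
  -- descend the coordinates to `K`
  obtain ⟨c', hc'K, hc'⟩ := exists_coords_mem_of_forall_mem (K := K.toSubfield)
    (fun i n ↦ (z i n : ℂ)) (fun i n ↦ intCast_mem _ _) c (fun n ↦ cuspCoeff C n) hC hcoef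
  -- clear denominators
  obtain ⟨D, hD0, hD⟩ := exists_int_mul_isIntegral_of_mem K c' hc'K
  refine ⟨D, hD0, fun n ↦ ?_⟩
  rw [hc' n, Finset.mul_sum]
  refine IsIntegral.sum _ fun i _ ↦ ?_
  rw [← mul_assoc]
  exact (hD i).mul isIntegral_intCast

where
  /-- Integers are integral. [folklore] -/
  isIntegral_intCast {z : ℤ} : IsIntegral ℤ (z : ℂ) := by
    simpa using (isIntegral_algebraMap (R := ℤ) (A := ℂ) (x := z))

end CuspDenominators

/-! ### Transfer through `Δ` and the main statement -/

section Main

/-- Multiplying a series with `D`-integral coefficients by an integer series keeps the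
coefficients `D`-integral. [folklore] -/
theorem isIntegral_mul_coeff_mul_map (Q : PowerSeries ℂ) (v : PowerSeries ℤ) (D : ℤ)
    (hQ : ∀ n, IsIntegral ℤ ((D : ℂ) * Q.coeff n)) (n : ℕ) :
    IsIntegral ℤ ((D : ℂ) * (Q * v.map (Int.castRingHom ℂ)).coeff n) := by
  rw [PowerSeries.coeff_mul, Finset.mul_sum]
  refine IsIntegral.sum _ fun p _ ↦ ?_
  rw [PowerSeries.coeff_map, ← mul_assoc]
  exact (hQ _).mul (by simpa using (isIntegral_algebraMap (R := ℤ) (A := ℂ) (x := v.coeff p.2)))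

variable (K : IntermediateField ℚ ℂ) [FiniteDimensional ℚ K] {N : ℕ} [NeZero N] {k : ℤ}

omit [NeZero N] in
/-- `N^{(k-1)⁺} = N^{k-1} · N^{(1-k)⁺}` in `ℂ`. [folklore] -/
theorem natCast_pow_toNat_eq (hN : (N : ℂ) ≠ 0) (k : ℤ) :
    ((N : ℂ)) ^ (k - 1).toNat = (N : ℂ) ^ (k - 1) * (N : ℂ) ^ (1 - k).toNat := by
  rcases le_or_gt 1 k with hk | hk
  · rw [Int.toNat_eq_zero.mpr (by omega : 1 - k ≤ 0), pow_zero, mul_one, ← zpow_natCast,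
      Int.toNat_of_nonneg (by omega : 0 ≤ k - 1)]
  · rw [Int.toNat_eq_zero.mpr (by omega : k - 1 ≤ 0), pow_zero, ← zpow_natCast,
      Int.toNat_of_nonneg (by omega : 0 ≤ 1 - k), ← zpow_add₀ hN, show k - 1 + (1 - k) = 0 by ring,
      zpow_zero]

/-- **Bounded denominators for `K`-rational forms on `Γ(N)`** (`K ⊂ ℂ` a number field, weight
`k ≥ -11`, in particular every weight carrying nonzero forms): if `g ∈ M_k(Γ(N))` has all
`q_N`-coefficients in `K`, then `D · aₙ(g)` is integral over `ℤ` for all `n`, for some integer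
`D ≠ 0`.  Proof: `C = (g ∣ diag(N,1))·Δ ∈ S_{k+12}(Γ₁(N²))` has `q`-expansion
`N^{k-1}(∑ aₙ qⁿ)·q∏(1-qⁿ)²⁴`, `K`-rational, so `D₀·(coefficients of C)` are integral
(`exists_int_mul_isIntegral_cuspCoeff`); dividing by the unit `∏(1-qⁿ)²⁴ ∈ ℤ⟦q⟧ˣ` and shifting,
`D₀ N^{k-1} aₙ` is integral. [cite: ShimuraIATAF1971, Thm. 3.52] -/
theorem exists_int_mul_isIntegral_coeff (hk : 1 ≤ k + 12) {g : ℍ → ℂ}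
    (hg : g ∈ formSpace (CongruenceSubgroup.Gamma N) k) (hgK : IsRat K.toSubfield N g) :
    ∃ D : ℤ, D ≠ 0 ∧ ∀ n, IsIntegral ℤ ((D : ℂ) * (qExpansion (N : ℝ) g).coeff n) := by
  have hN : (N : ℂ) ≠ 0 := by exact_mod_cast NeZero.ne N
  -- the cusp form `C` and its `q`-expansion
  set C := levelRaiseCusp hg with hCdef
  set P : PowerSeries ℂ := qExpansion 1 (levelRaise N k g) with hP
  have hPcoeff : ∀ n, P.coeff n = (N : ℂ) ^ (k - 1) * (qExpansion (N : ℝ) g).coeff n :=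
    qExpansion_coeff_levelRaise N hg
  have hCexp : qExpansion 1 (⇑C) = P * (PowerSeries.X * formalDeltaUnit).map (Int.castRingHom ℂ) :=
    qExpansion_levelRaiseCusp hg
  -- `C` is `K`-rational
  have hNK : (N : ℂ) ^ (k - 1) ∈ K.toSubfield := zpow_mem (natCast_mem _ N) _
  have hPK : ∀ n, P.coeff n ∈ K.toSubfield := fun n ↦ by
    rw [hPcoeff]
    exact mul_mem hNK (hgK n)
  have hCK : ∀ n, cuspCoeff C n ∈ K.toSubfield := by
    intro n
    show (qExpansion 1 (⇑C)).coeff n ∈ K.toSubfield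
    rw [hCexp, PowerSeries.coeff_mul]
    refine sum_mem fun p _ ↦ mul_mem (hPK _) ?_
    rw [PowerSeries.coeff_map]
    exact intCast_mem _ _
  -- denominators of `C`
  obtain ⟨D₀, hD₀, hD₀int⟩ := exists_int_mul_isIntegral_cuspCoeff K hk C hCK
  -- divide by the unit `formalDeltaUnit` and shift by `X`
  have hunit : IsUnit formalDeltaUnit := by
    rw [PowerSeries.isUnit_iff_constantCoeff, constantCoeff_formalDeltaUnit]
    exact isUnit_one
  obtain ⟨u, hu⟩ := hunit
  have hPX : P * PowerSeries.X = qExpansion 1 (⇑C) * (↑u⁻¹ : PowerSeries ℤ).map (Int.castRingHom ℂ) := by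
    rw [hCexp, mul_assoc, ← map_mul, mul_assoc, ← hu, Units.mul_inv, mul_one, PowerSeries.map_X]
  have hint : ∀ n, IsIntegral ℤ ((D₀ : ℂ) * (P * PowerSeries.X).coeff n) := by
    intro n
    rw [hPX]
    exact isIntegral_mul_coeff_mul_map _ _ D₀ hD₀int n
  -- read off `D₀ N^{(k-1)⁺} aₙ = (D₀ N^{k-1} aₙ) · N^{(1-k)⁺}`
  refine ⟨D₀ * N ^ (k - 1).toNat, mul_ne_zero hD₀ (pow_ne_zero _ (by exact_mod_cast NeZero.ne N)), fun n ↦ ?_⟩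
  have h1 := hint (n + 1)
  rw [PowerSeries.coeff_succ_mul_X, hPcoeff, ← mul_assoc] at h1
  have h2 : ((D₀ * N ^ (k - 1).toNat : ℤ) : ℂ) * (qExpansion (N : ℝ) g).coeff n =
      ((D₀ : ℂ) * (N : ℂ) ^ (k - 1) * (qExpansion (N : ℝ) g).coeff n) * ((N ^ (1 - k).toNat : ℕ) : ℂ) := by
    push_cast
    rw [natCast_pow_toNat_eq hN k]
    ring
  rw [h2]
  exact h1.mul (by simpa using (isIntegral_algebraMap (R := ℤ) (A := ℂ) (x := ((N ^ (1 - k).toNat : ℕ) : ℤ))))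

end Main

end Literature.NumberTheory.ModularForms

end
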